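import Summits.Ventures.Crystal3D.Theorems.StickyWulffConstantCoaxialWallLawOffPlane
import Summits.Ventures.Crystal3D.Theorems.StickyWulffConstantCoaxialWallLawInPlaneRunEndsPredDisjoint
import HarnessLib

/-!
# The one-grain end-law assembly for DISJOINT co-axial pairs (translations, height-incommensurate pairs): constant `√6/4` from grain 1's ends alone

HONEST FRAMING. Part of the venture `Summits/Ventures/Crystal3D` (cell `crystal3d-full`), helper
`--supports` the crux `CoaxialWallLaw` (stmt-Ventures-19481, `route-Ventures-StickyWulffConstant`),
REGISTERED line `WallLedgerF` (planner cf-p1 gen 16), open stub `stub_coaxialTwoSlabAdhesion`.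
RUNG CREDIT ONLY; F-C1 not moved.  GLUE for the (F-γ) case of the planner's ledger (INCOMMENSURATE heights: lit's
rigid optimum `T*` at `{112}` has `t_z = d/2`): there every layer of one grain lies strictly between the layers of the
other, the grains are DISJOINT (`coaxial_disjoint_of_heightIncompat`), no composition layers exist, and the located
in-plane rows of grain 1 alone carry the FULL flux (`…InPlaneRunEndsPredDisjoint`): along the best class
`√2·max|⟪Lvᵢ,e₃⟫| ≥ (√6/2)·sin θ`.  Hence ANY local law with budget at GRAIN 1's located ends (a census row in grain 1's
own plane system; grain 2's geometry enters only through the row) gives the stub's inequality with constant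
`√6/4 ≈ 0.612 > ½`:

* `coaxial_disjoint_of_heightIncompat` — `⟪L⁻¹(s₂ − s₁), e₃⟫ ∉ √(2/3)·ℤ ⇒ Λ₁ ∩ Λ₂ = ∅`.
* `endLaw_payers_ge_class_oneGrain` — disjoint pair, per class: `Σ_window(12 − deg) ≥ √2|⟪Lv,e₃⟫|πρ² − (12√2π+120R₀)ρ − Σ_window β`.
* **`coaxialTwoSlabAdhesion_of_endLaw_oneGrain`** — disjoint co-axial pair, explicit frame, `R₀ = 10`: for every filling and
  every `β ≥ 0` with «every located end of grain 1 pays `12 − deg e ≥ 1 − β(e)`»: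
  `cross ≤ D(Y) + (φ₁ + φ₂ − (√6/4)·sin θ)πρ² + C(1+h)ρ + ½·Σ_window β`.

WHAT THIS IS NOT: no local law / census row is proved here (the (F-γ) bi-planar row is spec'd in memo F-LAMINAR-g8 §5);
F-C1 not moved.
-/

noncomputable section

namespace Summit.Ventures.Crystal3D.Theorems

open Summit.Ventures.Crystal3D Finset
open Literature.MathematicalPhysics.StatisticalMechanics (fccStacking barlowStacking IsHaggSeq
  contactDeficiency triangularVec₁ triangularVec₂ barlowOffset layerNormal)
open scoped InnerProductSpace

/-! ## Height-incommensurate pairs are disjoint -/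

/-- **A height-incommensurate co-axial pair has disjoint grains.** -/
theorem coaxial_disjoint_of_heightIncompat
    (A₁ : EuclideanSpace ℝ (Fin 3) ≃ₗᵢ[ℝ] EuclideanSpace ℝ (Fin 3)) (t₁ : EuclideanSpace ℝ (Fin 3))
    (A₂ : EuclideanSpace ℝ (Fin 3) ≃ₗᵢ[ℝ] EuclideanSpace ℝ (Fin 3)) (t₂ : EuclideanSpace ℝ (Fin 3))
    (L : EuclideanSpace ℝ (Fin 3) ≃ₗᵢ[ℝ] EuclideanSpace ℝ (Fin 3)) (s₁ s₂ : EuclideanSpace ℝ (Fin 3))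
    {σ σ' : ℤ → ℤ}
    (hsub₁ : (fun p => A₁ p + t₁) '' fccStacking 1 (Real.sqrt (2 / 3)) ⊆
      (fun p => L p + s₁) '' barlowStacking 1 (Real.sqrt (2 / 3)) σ)
    (hsub₂ : (fun p => A₂ p + t₂) '' fccStacking 1 (Real.sqrt (2 / 3)) ⊆
      (fun p => L p + s₂) '' barlowStacking 1 (Real.sqrt (2 / 3)) σ')
    (hinc : ¬ ∃ k₀ : ℤ, (L.symm (s₂ - s₁)) 2 = k₀ * Real.sqrt (2 / 3)) :
    ∀ p ∈ (fun q => A₁ q + t₁) '' fccStacking 1 (Real.sqrt (2 / 3)),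
      p ∉ (fun q => A₂ q + t₂) '' fccStacking 1 (Real.sqrt (2 / 3)) := by
  intro p hp₁ hp₂
  obtain ⟨k, hk⟩ := onPlane_of_mem_coaxialGrain A₁ t₁ L s₁ hsub₁ hp₁
  obtain ⟨k', hk'⟩ := onPlane_of_mem_coaxialGrain A₂ t₂ L s₂ hsub₂ hp₂
  refine hinc ⟨k - k', ?_⟩
  have e : L.symm (s₂ - s₁) = L.symm (p - s₁) - L.symm (p - s₂) := by rw [← map_sub]; congr 1; abel
  rw [e, PiLp.sub_apply, hk, hk']; push_cast; ring

/-! ## The per-class payer bound, one grain, disjoint pair -/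

open scoped Classical in
/-- **Per-class payer bound from a local law at grain 1's located ends only, disjoint co-axial pair (full flux).**
See the module docstring. -/
theorem endLaw_payers_ge_class_oneGrain
    (A₁ : EuclideanSpace ℝ (Fin 3) ≃ₗᵢ[ℝ] EuclideanSpace ℝ (Fin 3)) (t₁ : EuclideanSpace ℝ (Fin 3))
    (A₂ : EuclideanSpace ℝ (Fin 3) ≃ₗᵢ[ℝ] EuclideanSpace ℝ (Fin 3)) (t₂ : EuclideanSpace ℝ (Fin 3))
    (L : EuclideanSpace ℝ (Fin 3) ≃ₗᵢ[ℝ] EuclideanSpace ℝ (Fin 3)) (s₁ s₂ : EuclideanSpace ℝ (Fin 3))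
    {σ σ' : ℤ → ℤ} (hσ : IsHaggSeq σ) (hσ' : IsHaggSeq σ')
    (hsub₁ : (fun p => A₁ p + t₁) '' fccStacking 1 (Real.sqrt (2 / 3)) ⊆
      (fun p => L p + s₁) '' barlowStacking 1 (Real.sqrt (2 / 3)) σ)
    (hsub₂ : (fun p => A₂ p + t₂) '' fccStacking 1 (Real.sqrt (2 / 3)) ⊆
      (fun p => L p + s₂) '' barlowStacking 1 (Real.sqrt (2 / 3)) σ')
    (hdisj : ∀ p ∈ (fun q => A₁ q + t₁) '' fccStacking 1 (Real.sqrt (2 / 3)),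
      p ∉ (fun q => A₂ q + t₂) '' fccStacking 1 (Real.sqrt (2 / 3)))
    (X P₁ P₂ : Finset (EuclideanSpace ℝ (Fin 3))) (R₀ h ρ : ℝ) (hR₀ : 10 ≤ R₀) (hρ : R₀ ≤ ρ)
    (hX : ∀ p ∈ X, ∀ q ∈ X, p ≠ q → 1 ≤ dist p q)
    (hcell : ∀ p ∈ X, -(2 * R₀) ≤ p 2 ∧ p 2 ≤ h + 2 * R₀ ∧ p 0 ^ 2 + p 1 ^ 2 ≤ ρ ^ 2)
    (hP₁X : P₁ ⊆ X) (hP₂X : P₂ ⊆ X)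
    (hP₁ : ∀ p, p ∈ P₁ ↔ (p ∈ (fun q => A₁ q + t₁) '' fccStacking 1 (Real.sqrt (2 / 3)) ∧
      -(2 * R₀) ≤ p 2 ∧ p 2 ≤ -R₀ ∧ p 0 ^ 2 + p 1 ^ 2 ≤ ρ ^ 2))
    (hP₂ : ∀ p, p ∈ P₂ ↔ (p ∈ (fun q => A₂ q + t₂) '' fccStacking 1 (Real.sqrt (2 / 3)) ∧
      h + R₀ ≤ p 2 ∧ p 2 ≤ h + 2 * R₀ ∧ p 0 ^ 2 + p 1 ^ 2 ≤ ρ ^ 2))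
    (β : EuclideanSpace ℝ (Fin 3) → ℝ) (hβ : ∀ z, 0 ≤ β z)
    (hlaw₁ : ∀ e ∈ X, ∀ w ∈ fccSlots,
      ⟪A₁ w, L (EuclideanSpace.single (2 : Fin 3) (1 : ℝ))⟫_ℝ = 0 →
      e ∈ (fun q => A₁ q + t₁) '' fccStacking 1 (Real.sqrt (2 / 3)) →
      e - A₁ w ∈ X → e + A₁ w ∉ X → (-R₀ - 2 ≤ e 2 ∧ e 2 ≤ h + R₀ + 2) →
      (1 : ℝ) - β e ≤ (12 : ℝ) - ((X.filter fun q => dist e q = 1).card : ℝ))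
    (i j : ℤ) (hv : ‖(i : ℝ) • triangularVec₁ (1 : ℝ) + (j : ℝ) • triangularVec₂ 1‖ = 1) :
    Real.sqrt 2 * |⟪L ((i : ℝ) • triangularVec₁ (1 : ℝ) + (j : ℝ) • triangularVec₂ 1),
        EuclideanSpace.single (2 : Fin 3) (1 : ℝ)⟫_ℝ| * Real.pi * ρ ^ 2 -
        (12 * Real.sqrt 2 * Real.pi + 120 * R₀) * ρ -
        ∑ z ∈ X.filter (fun z => -R₀ - 2 ≤ z 2 ∧ z 2 ≤ h + R₀ + 2), β z ≤
      ∑ z ∈ X.filter (fun z => -R₀ - 2 ≤ z 2 ∧ z 2 ≤ h + R₀ + 2),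
        ((12 : ℝ) - ((X.filter fun q => dist z q = 1).card : ℝ)) := by
  set e₃ : EuclideanSpace ℝ (Fin 3) := EuclideanSpace.single (2 : Fin 3) (1 : ℝ) with he₃
  set v : EuclideanSpace ℝ (Fin 3) := (i : ℝ) • triangularVec₁ (1 : ℝ) + (j : ℝ) • triangularVec₂ 1 with hvdef
  set Λ₁ := (fun q => A₁ q + t₁) '' fccStacking 1 (Real.sqrt (2 / 3)) with hΛ₁
  set Λ₂ := (fun q => A₂ q + t₂) '' fccStacking 1 (Real.sqrt (2 / 3)) with hΛ₂
  -- the class as a non-descending slot of grain 1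
  obtain ⟨ε, hε, w, hw, hAw, hup⟩ := exists_up_slot_of_inPlane_class A₁ t₁ L s₁ hσ hsub₁ i j hv
  -- `Λ₂` is invariant under `± A₁ w`
  have hper : ∀ x ∈ Λ₂, ∀ a b : ℤ, x + L ((a : ℝ) • triangularVec₁ (1 : ℝ) + (b : ℝ) • triangularVec₂ 1) ∈ Λ₂ :=
    fun x hx a b => coaxial_inPlane_slot_mem A₂ t₂ L s₂ hσ' hsub₂ hx a b
  have hinv₂ : ∀ x, x ∈ Λ₂ → x + A₁ w ∈ Λ₂ ∧ x - A₁ w ∈ Λ₂ := by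
    intro x hx
    rcases hε with h1 | h1
    · rw [h1, one_smul] at hAw
      refine ⟨by rw [hAw]; exact hper x hx i j, ?_⟩
      have e : x - A₁ w = x + L ((((-i : ℤ)) : ℝ) • triangularVec₁ (1 : ℝ) + (((-j : ℤ)) : ℝ) • triangularVec₂ 1) := by
        rw [hAw, sub_eq_add_neg, ← map_neg]
        congr 2
        push_cast
        module
      rw [e]; exact hper x hx (-i) (-j)
    · rw [h1, neg_one_smul, map_neg] at hAw
      refine ⟨?_, by rw [hAw, sub_neg_eq_add]; exact hper x hx i j⟩
      have e : x + A₁ w = x + L ((((-i : ℤ)) : ℝ) • triangularVec₁ (1 : ℝ) + (((-j : ℤ)) : ℝ) • triangularVec₂ 1) := by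
        rw [hAw, ← map_neg]
        congr 2
        push_cast
        module
      rw [e]; exact hper x hx (-i) (-j)
  have hE := card_inPlane_runEndsPred_ge_of_disjoint A₁ t₁ A₂ t₂ X P₁ P₂ R₀ h ρ hR₀ hρ hX hcell hP₁X hP₂X hP₁ hP₂
    hdisj hw hup hinv₂
  -- the slot carries the class flux and lies in the basal plane
  have habs : |⟪A₁ w, e₃⟫_ℝ| = |⟪L v, e₃⟫_ℝ| := by
    rw [hAw]
    rcases hε with h1 | h1
    · rw [h1, one_smul]
    · rw [h1, neg_one_smul, map_neg, inner_neg_left, abs_neg]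
  rw [habs] at hE
  have hvn : ⟪v, e₃⟫_ℝ = 0 := by
    rw [hvdef, inner_add_left, inner_smul_left, inner_smul_left, inner_triangularVec_e₃.1,
      inner_triangularVec_e₃.2]
    simp
  have hdn : ⟪A₁ w, L e₃⟫_ℝ = 0 := by
    rw [hAw, LinearIsometryEquiv.inner_map_map, inner_smul_left, hvn, mul_zero]
  -- the window and the end set
  set Xwin := X.filter fun z => -R₀ - 2 ≤ z 2 ∧ z 2 ≤ h + R₀ + 2 with hXwin
  set E₁ := X.filter fun e => e ∈ Λ₁ ∧ e + A₁ w ∉ X ∧ e - A₁ w ∈ X ∧ -R₀ - 2 ≤ e 2 ∧ e 2 ≤ h + R₀ + 2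
    with hE₁
  have hsub : E₁ ⊆ Xwin := by
    intro e he
    obtain ⟨heX, -, -, -, hlo, hhi⟩ := mem_filter.1 he
    exact mem_filter.2 ⟨heX, hlo, hhi⟩
  have hone : ∀ z ∈ E₁, (1 : ℝ) - β z ≤ (12 : ℝ) - ((X.filter fun q => dist z q = 1).card : ℝ) := by
    intro z hz
    obtain ⟨hzX, hzΛ, hsucc, hpred, hlo, hhi⟩ := mem_filter.1 hz
    exact hlaw₁ z hzX w hw hdn hzΛ hpred hsucc ⟨hlo, hhi⟩
  have hnonneg' : ∀ z ∈ Xwin, z ∉ E₁ →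
      (0 : ℝ) ≤ (12 : ℝ) - ((X.filter fun q => dist z q = 1).card : ℝ) + β z := by
    intro z _ _
    have := card_filter_dist_eq_one_le_twelve X hX z
    have h' : (((X.filter fun q => dist z q = 1).card : ℕ) : ℝ) ≤ 12 := by exact_mod_cast this
    have h0 := hβ z
    linarith
  have hcard : ((E₁.card : ℕ) : ℝ) = ∑ z ∈ E₁, (1 : ℝ) := by
    rw [sum_const, nsmul_eq_mul, mul_one]
  have hstep : ∑ z ∈ E₁, (1 : ℝ) - ∑ z ∈ Xwin, β z ≤
      ∑ z ∈ Xwin, ((12 : ℝ) - ((X.filter fun q => dist z q = 1).card : ℝ)) := by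
    have h1 : ∑ z ∈ E₁, ((1 : ℝ) - β z) ≤
        ∑ z ∈ E₁, ((12 : ℝ) - ((X.filter fun q => dist z q = 1).card : ℝ)) := sum_le_sum hone
    have h2 : ∑ z ∈ E₁, (((12 : ℝ) - ((X.filter fun q => dist z q = 1).card : ℝ)) + β z) ≤
        ∑ z ∈ Xwin, (((12 : ℝ) - ((X.filter fun q => dist z q = 1).card : ℝ)) + β z) :=
      sum_le_sum_of_subset_of_nonneg hsub hnonneg'
    have h3 : ∑ z ∈ E₁, β z ≤ ∑ z ∈ Xwin, β z :=
      sum_le_sum_of_subset_of_nonneg hsub (fun z _ _ => hβ z)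
    rw [sum_sub_distrib] at h1
    rw [sum_add_distrib, sum_add_distrib] at h2
    linarith
  linarith [hE, hcard, hstep]

/-! ## The one-grain assembly -/

open scoped Classical in
/-- **The one-grain end-law assembly of `stub_coaxialTwoSlabAdhesion`** (disjoint co-axial pair, explicit frame,
constant `√6/4`, uniform in the local law at grain 1's located ends).  See the module docstring. -/
theorem coaxialTwoSlabAdhesion_of_endLaw_oneGrain
    (A₁ : EuclideanSpace ℝ (Fin 3) ≃ₗᵢ[ℝ] EuclideanSpace ℝ (Fin 3)) (t₁ : EuclideanSpace ℝ (Fin 3))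
    (A₂ : EuclideanSpace ℝ (Fin 3) ≃ₗᵢ[ℝ] EuclideanSpace ℝ (Fin 3)) (t₂ : EuclideanSpace ℝ (Fin 3))
    (L : EuclideanSpace ℝ (Fin 3) ≃ₗᵢ[ℝ] EuclideanSpace ℝ (Fin 3)) (s₁ s₂ : EuclideanSpace ℝ (Fin 3))
    {σ σ' : ℤ → ℤ} (hσ : IsHaggSeq σ) (hσ' : IsHaggSeq σ')
    (hsub₁ : (fun p => A₁ p + t₁) '' fccStacking 1 (Real.sqrt (2 / 3)) ⊆
      (fun p => L p + s₁) '' barlowStacking 1 (Real.sqrt (2 / 3)) σ)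
    (hsub₂ : (fun p => A₂ p + t₂) '' fccStacking 1 (Real.sqrt (2 / 3)) ⊆
      (fun p => L p + s₂) '' barlowStacking 1 (Real.sqrt (2 / 3)) σ')
    (hdisj : ∀ p ∈ (fun q => A₁ q + t₁) '' fccStacking 1 (Real.sqrt (2 / 3)),
      p ∉ (fun q => A₂ q + t₂) '' fccStacking 1 (Real.sqrt (2 / 3))) :
    ∃ C : ℝ, ∀ h : ℝ, 0 ≤ h → ∀ ρ : ℝ, 10 ≤ ρ →
      ∀ X P₁ P₂ : Finset (EuclideanSpace ℝ (Fin 3)),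
      (∀ p ∈ X, ∀ q ∈ X, p ≠ q → 1 ≤ dist p q) → P₁ ⊆ X → P₂ ⊆ X \ P₁ →
      (∀ p ∈ X, -(2 * 10) ≤ p 2 ∧ p 2 ≤ h + 2 * 10 ∧ p 0 ^ 2 + p 1 ^ 2 ≤ ρ ^ 2) →
      (∀ p, p ∈ P₁ ↔ (p ∈ (fun q => A₁ q + t₁) '' fccStacking 1 (Real.sqrt (2 / 3)) ∧
        -(2 * 10) ≤ p 2 ∧ p 2 ≤ -10 ∧ p 0 ^ 2 + p 1 ^ 2 ≤ ρ ^ 2)) →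
      (∀ p, p ∈ P₂ ↔ (p ∈ (fun q => A₂ q + t₂) '' fccStacking 1 (Real.sqrt (2 / 3)) ∧
        h + 10 ≤ p 2 ∧ p 2 ≤ h + 2 * 10 ∧ p 0 ^ 2 + p 1 ^ 2 ≤ ρ ^ 2)) →
      ∀ β : EuclideanSpace ℝ (Fin 3) → ℝ, (∀ z, 0 ≤ β z) →
      (∀ e ∈ X, ∀ w ∈ fccSlots,
        ⟪A₁ w, L (EuclideanSpace.single (2 : Fin 3) (1 : ℝ))⟫_ℝ = 0 →
        e ∈ (fun q => A₁ q + t₁) '' fccStacking 1 (Real.sqrt (2 / 3)) →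
        e - A₁ w ∈ X → e + A₁ w ∉ X → (-(10 : ℝ) - 2 ≤ e 2 ∧ e 2 ≤ h + 10 + 2) →
        (1 : ℝ) - β e ≤ (12 : ℝ) - ((X.filter fun q => dist e q = 1).card : ℝ)) →
      ((((P₁ ×ˢ (X \ P₁)).filter fun pq => dist pq.1 pq.2 = 1).card : ℕ) : ℝ) +
        ((((P₂ ×ˢ ((X \ P₁) \ P₂)).filter fun pq => dist pq.1 pq.2 = 1).card : ℕ) : ℝ) ≤
        contactDeficiency ((X \ P₁) \ P₂) +
          (Real.sqrt 2 / 4 * ∑ᶠ w ∈ {w ∈ fccStacking 1 (Real.sqrt (2 / 3)) | ‖w‖ = 1},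
              |⟪w, A₁.symm (EuclideanSpace.single (2 : Fin 3) (1 : ℝ))⟫_ℝ| +
            Real.sqrt 2 / 4 * ∑ᶠ w ∈ {w ∈ fccStacking 1 (Real.sqrt (2 / 3)) | ‖w‖ = 1},
              |⟪w, A₂.symm (EuclideanSpace.single (2 : Fin 3) (1 : ℝ))⟫_ℝ| -
            (Real.sqrt 6 / 4 : ℝ) * Real.sqrt (1 - ⟪L (EuclideanSpace.single (2 : Fin 3) (1 : ℝ)),
              (EuclideanSpace.single (2 : Fin 3) (1 : ℝ))⟫_ℝ ^ 2)) * Real.pi * ρ ^ 2 +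
          C * (1 + h) * ρ +
          1 / 2 * ∑ z ∈ X.filter (fun z => -(10 : ℝ) - 2 ≤ z 2 ∧ z 2 ≤ h + 10 + 2), β z := by
  set e₃ : EuclideanSpace ℝ (Fin 3) := EuclideanSpace.single (2 : Fin 3) (1 : ℝ) with he₃
  set s : ℝ := Real.sqrt (1 - ⟪L e₃, e₃⟫_ℝ ^ 2) with hs
  have hs0 : 0 ≤ s := Real.sqrt_nonneg _
  obtain ⟨Cpa, hCpa⟩ := twoSlab_cross_le_of_deficit_budget A₁ t₁ A₂ t₂ 10 (by norm_num)
  set C₀ : ℝ := 12 * Real.sqrt 2 * Real.pi + 120 * 10 with hC₀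
  have hC₀0 : 0 ≤ C₀ := by positivity
  obtain ⟨hn₁, hn₂, hn₁₂⟩ := norm_triangularVec_one
  have hv₁ : (((1 : ℤ) : ℝ)) • triangularVec₁ (1 : ℝ) + (((0 : ℤ) : ℝ)) • triangularVec₂ (1 : ℝ) =
      triangularVec₁ 1 := by simp
  have hv₂ : (((0 : ℤ) : ℝ)) • triangularVec₁ (1 : ℝ) + (((1 : ℤ) : ℝ)) • triangularVec₂ (1 : ℝ) =
      triangularVec₂ 1 := by simp
  have hv₃ : (((-1 : ℤ) : ℝ)) • triangularVec₁ (1 : ℝ) + (((1 : ℤ) : ℝ)) • triangularVec₂ (1 : ℝ) =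
      triangularVec₂ 1 - triangularVec₁ 1 := by push_cast; module
  refine ⟨Cpa + C₀ / 2, ?_⟩
  intro h hh ρ hρ X P₁ P₂ hX hP₁X hP₂X₁ hcell hP₁ hP₂ β hβ hlaw₁
  have hP₂X : P₂ ⊆ X := hP₂X₁.trans sdiff_subset
  have hρ0 : (0 : ℝ) ≤ ρ := by linarith
  -- the three per-class payer bounds (grain 1 only)
  have h₁ := endLaw_payers_ge_class_oneGrain A₁ t₁ A₂ t₂ L s₁ s₂ hσ hσ' hsub₁ hsub₂ hdisj X P₁ P₂ 10 h ρ le_rfl hρ hX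
    hcell hP₁X hP₂X hP₁ hP₂ β hβ hlaw₁ 1 0 (by rw [hv₁]; exact hn₁)
  have h₂ := endLaw_payers_ge_class_oneGrain A₁ t₁ A₂ t₂ L s₁ s₂ hσ hσ' hsub₁ hsub₂ hdisj X P₁ P₂ 10 h ρ le_rfl hρ hX
    hcell hP₁X hP₂X hP₁ hP₂ β hβ hlaw₁ 0 1 (by rw [hv₂]; exact hn₂)
  have h₃ := endLaw_payers_ge_class_oneGrain A₁ t₁ A₂ t₂ L s₁ s₂ hσ hσ' hsub₁ hsub₂ hdisj X P₁ P₂ 10 h ρ le_rfl hρ hX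
    hcell hP₁X hP₂X hP₁ hP₂ β hβ hlaw₁ (-1) 1 (by rw [hv₃]; exact hn₁₂)
  rw [hv₁] at h₁
  rw [hv₂] at h₂
  rw [hv₃] at h₃
  -- the best class carries half of the total flux, which carries the sine
  set x₁ : ℝ := ⟪L (triangularVec₁ 1), e₃⟫_ℝ with hx₁
  set x₂ : ℝ := ⟪L (triangularVec₂ 1), e₃⟫_ℝ with hx₂
  have hx₃ : ⟪L (triangularVec₂ 1 - triangularVec₁ 1), e₃⟫_ℝ = x₂ - x₁ := by
    rw [map_sub, inner_sub_left]
  rw [hx₃] at h₃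
  have hflux : Real.sqrt 6 * s ≤ Real.sqrt 2 * (|x₁| + |x₂| + |x₂ - x₁|) := by
    have := coaxial_sine_le_inPlaneClasses L
    rw [hx₃] at this
    exact this
  set S : ℝ := ∑ z ∈ X.filter (fun z => -(10 : ℝ) - 2 ≤ z 2 ∧ z 2 ≤ h + 10 + 2),
    ((12 : ℝ) - ((X.filter fun q => dist z q = 1).card : ℝ)) with hS
  set B : ℝ := ∑ z ∈ X.filter (fun z => -(10 : ℝ) - 2 ≤ z 2 ∧ z 2 ≤ h + 10 + 2), β z with hB
  have hpay : (Real.sqrt 6 / 2 * s) * Real.pi * ρ ^ 2 - C₀ * (1 + h) * ρ - B ≤ S := by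
    set Q : ℝ := Real.sqrt 2 * Real.pi * ρ ^ 2 with hQ
    have hQ0 : 0 ≤ Q := by positivity
    have e₁ : Real.sqrt 2 * |x₁| * Real.pi * ρ ^ 2 = |x₁| * Q := by rw [hQ]; ring
    have e₂ : Real.sqrt 2 * |x₂| * Real.pi * ρ ^ 2 = |x₂| * Q := by rw [hQ]; ring
    have e₃' : Real.sqrt 2 * |x₂ - x₁| * Real.pi * ρ ^ 2 = |x₂ - x₁| * Q := by rw [hQ]; ring
    rw [e₁] at h₁
    rw [e₂] at h₂
    rw [e₃'] at h₃
    have eC : C₀ * ρ = (12 * Real.sqrt 2 * Real.pi + 120 * 10) * ρ := by rw [hC₀]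
    have hbest : 1 / 2 * (|x₁| + |x₂| + |x₂ - x₁|) * Q - C₀ * ρ - B ≤ S := by
      rw [eC]
      rcases two_mul_abs_ge_sum_three x₁ x₂ with hm | hm | hm
      · have := mul_le_mul_of_nonneg_right hm hQ0
        linarith
      · have := mul_le_mul_of_nonneg_right hm hQ0
        linarith
      · have := mul_le_mul_of_nonneg_right hm hQ0
        linarith
    have h1 : Real.sqrt 6 * s * (Real.pi * ρ ^ 2) ≤ (|x₁| + |x₂| + |x₂ - x₁|) * Q := by
      have := mul_le_mul_of_nonneg_right hflux (show (0 : ℝ) ≤ Real.pi * ρ ^ 2 by positivity)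
      have eQ : Real.sqrt 2 * (|x₁| + |x₂| + |x₂ - x₁|) * (Real.pi * ρ ^ 2) = (|x₁| + |x₂| + |x₂ - x₁|) * Q := by
        rw [hQ]; ring
      linarith [eQ]
    have h2 : C₀ * ρ ≤ C₀ * (1 + h) * ρ := by
      have : 0 ≤ C₀ * h * ρ := by positivity
      linarith [show C₀ * (1 + h) * ρ = C₀ * ρ + C₀ * h * ρ by ring]
    have e4 : (Real.sqrt 6 / 2 * s) * Real.pi * ρ ^ 2 = 1 / 2 * (Real.sqrt 6 * s * (Real.pi * ρ ^ 2)) := by ring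
    rw [e4]
    linarith [h1, h2, hbest]
  -- the payer assembly with budget `B`
  have hfin := hCpa h hh ρ hρ X P₁ P₂ hX hP₁X hP₂X₁ hcell hP₁ hP₂ (Real.sqrt 6 / 2 * s) C₀ B hC₀0 hpay
  have e63 : Real.sqrt 6 / 2 * s / 2 = Real.sqrt 6 / 4 * s := by ring
  rw [e63] at hfin
  have eB : B / 2 = 1 / 2 * B := by ring
  linarith [hfin, eB]

end Summit.Ventures.Crystal3D.Theorems

end
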